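import Summits.HodgeConjecture.HodgeConjecture.Theorems.HodgeLocusCensusTwistCells
import HarnessLib

/-!
# HodgeLocusCensusPlaneRank — PROVED: the period matrix of every coordinate plane of the Fermat quartic fourfold has rank 6 = C(6,4) − 9 (cell pub-hlocus, LEAD gen 4, (T23))
HONEST FRAMING: certified instances and evidence bearing on the general Hodge conjecture; no claim.

The EXPLAINED component behind every (4,4) cell of the census is NL(Π) = {quartic fourfolds containing a plane}: smooth of codimension
h⁰(𝒪_{ℙ²}(4)) − dim G(3,6) = 15 − 9 = 6, and by Movasati's theorem on linear cycles the Hodge locus V_[Π] at the Fermat point IS this family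
(smooth, reduced), so the first-order rank of Movasati's 21 × 90 matrix [p_{i+j}([Π])] is 6. Kernel-PROVED here for all 64 planes
Π = V(x₀ − ζ^{2a₁+1}x₁, x₂ − ζ^{2a₃+1}x₃, x₄ − ζ^{2a₅+1}x₅) (b = id) at once, over every field of characteristic 0 with a primitive 8th root ζ:
`ivhsRankEq_plane (a₁ a₃ a₅) : IvhsRankEq 4 4 6 [(1, plane44 a₁ a₃ a₅)]`. MECHANISM (the structure theorem, also proved): by the closed form
`period_plane44` an entry (i, j) is nonzero iff the pair sums of i + j are (2,2,2), and then it is ζ^{Σ_e (i_{2e}+j_{2e}+1)c_e}, which SPLITS as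
ζ^{Σ i_{2e} c_e} · ζ^{Σ (j_{2e}+1) c_e}; so the matrix is block-diagonal for the pair-sum type σ(i) ∈ {(2,0,0),(0,2,0),(0,0,2),(1,1,0),(1,0,1),(0,1,1)}
of the row (columns of type (2,2,2) − σ), each block an outer product of unit vectors: M = U · V with inner dimension 6 (`ivhsMatrix_plane_eq_mul`)
⇒ rank ≤ 6, and the 6 × 6 minor on the rows x₀², x₂², x₄², x₀x₂, x₀x₄, x₂x₄ and the columns x₂x₃x₄x₅, x₀x₁x₄x₅, x₀x₁x₂x₃, x₀x₂x₄x₅, x₀x₂x₃x₄, x₀x₁x₂x₄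
is DIAGONAL with unit entries ⇒ rank ≥ 6. Numerically (engine A, exact over ℚ(ζ₈) and mod 1048601/1048609): rank 6 for (a₁,a₃,a₅) = (0,0,0),
(1,2,0), (3,1,2); the same block count gives 19 = C(7,4) − 16 for a 3-plane of the quartic sixfold (engine A mod p: 19) — not typed here.
-/

namespace Summit.HodgeConjecture.HodgeConjecture.HodgeLocus.Census.PlaneRank
open TwistCells

/-- the six pair-sum types σ of a row index i ∈ I₂ (σ_e = i_{2e} + i_{2e+1}, |σ| = 2), first coordinates … -/
def sig0 : Fin 6 → ℕ := ![2, 0, 0, 1, 1, 0]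
/-- … second coordinates … -/
def sig1 : Fin 6 → ℕ := ![0, 2, 0, 1, 0, 1]
/-- … third coordinates. -/
def sig2 : Fin 6 → ℕ := ![0, 0, 2, 0, 1, 1]

/-- every row index of the (4,4) matrix has one of the six pair-sum types. -/
theorem row_cover : ∀ i ∈ indexSet 4 4 (4 / 2 * 4 - 4 - 2), ∃ k : Fin 6, i 0 + i 1 = sig0 k ∧ i 2 + i 3 = sig1 k ∧ i 4 + i 5 = sig2 k := by
  decide

/-- the six types are distinct. -/
theorem sig_inj : ∀ k k' : Fin 6, sig0 k = sig0 k' → sig1 k = sig1 k' → sig2 k = sig2 k' → k = k' := by decide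

/-- left factor U (rows × 6): ζ^{i₀c₁ + i₂c₃ + i₄c₅} on the block of the row's type, 0 elsewhere (c = 1 + 2a). -/
noncomputable def factorU {K : Type*} [Field K] (ζ : K) (a1 a3 a5 : ℕ) : Matrix (indexSet 4 4 (4 / 2 * 4 - 4 - 2)) (Fin 6) K :=
  fun i k => if i.1 0 + i.1 1 = sig0 k ∧ i.1 2 + i.1 3 = sig1 k ∧ i.1 4 + i.1 5 = sig2 k then
    ζ ^ (i.1 0 * (1 + 2 * a1) + i.1 2 * (1 + 2 * a3) + i.1 4 * (1 + 2 * a5)) else 0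

/-- right factor V (6 × columns): ζ^{(j₀+1)c₁ + (j₂+1)c₃ + (j₄+1)c₅} on the columns of the complementary type (2,2,2) − σ, 0 elsewhere. -/
noncomputable def factorV {K : Type*} [Field K] (ζ : K) (a1 a3 a5 : ℕ) : Matrix (Fin 6) (indexSet 4 4 4) K :=
  fun k j => if sig0 k + (j.1 0 + j.1 1) = 2 ∧ sig1 k + (j.1 2 + j.1 3) = 2 ∧ sig2 k + (j.1 4 + j.1 5) = 2 then
    ζ ^ ((j.1 0 + 1) * (1 + 2 * a1) + (j.1 2 + 1) * (1 + 2 * a3) + (j.1 4 + 1) * (1 + 2 * a5)) else 0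

/-- STRUCTURE THEOREM: the period matrix of a plane factors through K⁶ — M_[Π] = U · V (block-diagonal in the pair-sum type, rank-one blocks). -/
theorem ivhsMatrix_plane_eq_mul {K : Type*} [Field K] (ζ : K) (a1 a3 a5 : ℕ) :
    ivhsMatrix 4 4 ζ [(1, plane44 a1 a3 a5)] = factorU ζ a1 a3 a5 * factorV ζ a1 a3 a5 := by
  ext ⟨i, hi⟩ ⟨j, hj⟩
  obtain ⟨k₀, h0, h1, h2⟩ := row_cover i hi
  rw [Matrix.mul_apply, Finset.sum_eq_single k₀]
  · unfold ivhsMatrix periodComb factorU factorV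
    simp only [List.map, List.sum_cons, List.sum_nil, Rat.cast_one, one_mul, add_zero, period_plane44]
    rw [if_pos (show i 0 + i 1 = sig0 k₀ ∧ i 2 + i 3 = sig1 k₀ ∧ i 4 + i 5 = sig2 k₀ from ⟨h0, h1, h2⟩)]
    by_cases hc : sig0 k₀ + (j 0 + j 1) = 2 ∧ sig1 k₀ + (j 2 + j 3) = 2 ∧ sig2 k₀ + (j 4 + j 5) = 2
    · obtain ⟨c0, c1, c2⟩ := hc
      rw [if_pos (show sig0 k₀ + (j 0 + j 1) = 2 ∧ sig1 k₀ + (j 2 + j 3) = 2 ∧ sig2 k₀ + (j 4 + j 5) = 2 from ⟨c0, c1, c2⟩),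
        if_pos (show i 0 + j 0 + (i 1 + j 1) = 2 ∧ i 2 + j 2 + (i 3 + j 3) = 2 ∧ i 4 + j 4 + (i 5 + j 5) = 2 from
          ⟨by omega, by omega, by omega⟩), ← pow_add]
      congr 1
      ring
    · rw [if_neg hc, mul_zero,
        if_neg (show ¬ (i 0 + j 0 + (i 1 + j 1) = 2 ∧ i 2 + j 2 + (i 3 + j 3) = 2 ∧ i 4 + j 4 + (i 5 + j 5) = 2) from
          fun h => hc ⟨by omega, by omega, by omega⟩)]
  · intro k _ hk
    unfold factorU
    rw [if_neg, zero_mul]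
    intro h
    exact hk (sig_inj k k₀ (h.1.symm.trans h0) (h.2.1.symm.trans h1) (h.2.2.symm.trans h2))
  · intro h
    exact absurd (Finset.mem_univ k₀) h

/-- UPPER BOUND: rank M_[Π] ≤ 6. -/
theorem rank_le_six {K : Type*} [Field K] (ζ : K) (a1 a3 a5 : ℕ) : (ivhsMatrix 4 4 ζ [(1, plane44 a1 a3 a5)]).rank ≤ 6 := by
  rw [ivhsMatrix_plane_eq_mul]
  exact (Matrix.rank_mul_le_left _ _).trans (by simpa using Matrix.rank_le_card_width (factorU ζ a1 a3 a5))

/-- the six witness rows x₀², x₂², x₄², x₀x₂, x₀x₄, x₂x₄ ∈ I₂ … -/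
def rowPick : Fin 6 → indexSet 4 4 (4 / 2 * 4 - 4 - 2) :=
  ![⟨![2, 0, 0, 0, 0, 0], by decide⟩, ⟨![0, 0, 2, 0, 0, 0], by decide⟩, ⟨![0, 0, 0, 0, 2, 0], by decide⟩,
    ⟨![1, 0, 1, 0, 0, 0], by decide⟩, ⟨![1, 0, 0, 0, 1, 0], by decide⟩, ⟨![0, 0, 1, 0, 1, 0], by decide⟩]

/-- … and the six witness columns x₂x₃x₄x₅, x₀x₁x₄x₅, x₀x₁x₂x₃, x₀x₂x₄x₅, x₀x₂x₃x₄, x₀x₁x₂x₄ ∈ I₄ (pair-sum types complementary to the rows'). -/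
def colPick : Fin 6 → indexSet 4 4 4 :=
  ![⟨![0, 0, 1, 1, 1, 1], by decide⟩, ⟨![1, 1, 0, 0, 1, 1], by decide⟩, ⟨![1, 1, 1, 1, 0, 0], by decide⟩,
    ⟨![1, 0, 1, 0, 1, 1], by decide⟩, ⟨![1, 0, 1, 1, 1, 0], by decide⟩, ⟨![1, 1, 1, 0, 1, 0], by decide⟩]

/-- the 6 × 6 witness minor is diagonal: off-diagonal entries vanish … -/
theorem minor_offdiag {K : Type*} [Field K] (ζ : K) (a1 a3 a5 : ℕ) (a b : Fin 6) (hab : a ≠ b) :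
    ivhsMatrix 4 4 ζ [(1, plane44 a1 a3 a5)] (rowPick a) (colPick b) = 0 := by
  unfold ivhsMatrix periodComb
  fin_cases a <;> fin_cases b <;> simp_all [rowPick, colPick, period_plane44]

/-- … and diagonal entries are powers of ζ, hence nonzero. -/
theorem minor_diag_ne_zero {K : Type*} [Field K] (ζ : K) (hz : ζ ≠ 0) (a1 a3 a5 : ℕ) (a : Fin 6) :
    ivhsMatrix 4 4 ζ [(1, plane44 a1 a3 a5)] (rowPick a) (colPick a) ≠ 0 := by
  unfold ivhsMatrix periodComb
  fin_cases a <;> simp [rowPick, colPick, period_plane44, hz]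

/-- LOWER BOUND: rank M_[Π] ≥ 6 (the witness minor is a unit). -/
theorem six_le_rank {K : Type*} [Field K] (ζ : K) (hz : ζ ≠ 0) (a1 a3 a5 : ℕ) :
    6 ≤ (ivhsMatrix 4 4 ζ [(1, plane44 a1 a3 a5)]).rank := by
  classical
  set M := ivhsMatrix 4 4 ζ [(1, plane44 a1 a3 a5)] with hM
  have hS : M.submatrix rowPick colPick = Matrix.diagonal (fun a => M (rowPick a) (colPick a)) := by
    ext a b
    by_cases hab : a = b
    · subst hab
      rw [Matrix.diagonal_apply_eq, Matrix.submatrix_apply]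
    · rw [Matrix.diagonal_apply_ne _ hab, Matrix.submatrix_apply]
      exact minor_offdiag ζ a1 a3 a5 a b hab
  have hdet : IsUnit (M.submatrix rowPick colPick).det := by
    rw [hS, Matrix.det_diagonal]
    exact isUnit_iff_ne_zero.mpr (Finset.prod_ne_zero_iff.mpr fun a _ => minor_diag_ne_zero ζ hz a1 a3 a5 a)
  have hrank : (M.submatrix rowPick colPick).rank = 6 := by
    rw [Matrix.rank_of_isUnit _ ((Matrix.isUnit_iff_isUnit_det _).mpr hdet), Fintype.card_fin]
  calc 6 = (M.submatrix rowPick colPick).rank := hrank.symm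
    _ ≤ M.rank := Matrix.rank_submatrix_le M rowPick colPick

/-- PROVED ROW (all 64 coordinate planes of the Fermat quartic fourfold): `IvhsRankEq 4 4 6 [Π]` — the first-order Hodge locus of a plane has
codimension 6 = 15 − 9 = codim {X ⊃ Π}, over every characteristic-0 field and every primitive 8th root ζ. -/
theorem ivhsRankEq_plane (a1 a3 a5 : ℕ) : IvhsRankEq 4 4 6 [(1, plane44 a1 a3 a5)] := by
  intro K _ _ ζ hζ
  exact le_antisymm (rank_le_six ζ a1 a3 a5) (six_le_rank ζ (hζ.ne_zero (by norm_num)) a1 a3 a5)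

/-- the count: 6 = h⁰(𝒪_{ℙ²}(4)) − dim G(3,6) = C(6,4) − 3·3, and 6 = the number of pair-sum types (compositions of 2 into 3 parts ≤ 2);
for the sixfold the analogous numbers are C(7,4) − 4·4 = 19 = #{σ ∈ {0,1,2}⁴ : |σ| = 4}. -/
theorem plane_codim_count :
    Nat.choose 6 4 - 3 * 3 = 6 ∧ ((Finset.univ : Finset (Fin 3 → Fin 3)).filter (fun σ => ∑ e, (σ e : ℕ) = 2)).card = 6 ∧
    Nat.choose 7 4 - 4 * 4 = 19 ∧ ((Finset.univ : Finset (Fin 4 → Fin 3)).filter (fun σ => ∑ e, (σ e : ℕ) = 4)).card = 19 := by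
  refine ⟨by decide, by decide, by decide, by decide⟩

end Summit.HodgeConjecture.HodgeConjecture.HodgeLocus.Census.PlaneRank
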